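import Literature.Probability.LatticeModels.BlockExplorationNested
import Literature.Probability.LatticeModels.RandomClusterRimWiringOutside
import Literature.Probability.Percolation.BlockExplorationBasic
import HarnessLib

/-!
# The top-level identity of Kesten's ratio-limit scheme at one explored block (proved)

Topic `Literature/Probability/LatticeModels`; companion of
`Literature/Probability/Percolation/BlockExploration*.lean` (the exploration from inside of
D. Basu, A. Sapozhnikov, ECP 22 (2017), §2: explored set `𝒞 = explSet In Blk ω`, rim
`𝒟 = explRim In Blk ω`, datum event `explEvent In Blk U R = {𝒞 = U, 𝒟 = R}`, rim wired from inside
`explRimWired`), of `BlockExplorationNested.lean` (`explEvent_wired_rimHyps`: the saturated wired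
datum event satisfies the hypotheses of the rim-wiring Markov property) and of
`RandomClusterRimWiringOutside.lean` (`rcMeasure_real_condIndep_of_rim_wired_outside`: conditional
independence of the configurations on and off the edges touching the explored set).

For the free random-cluster measure `P = φ_{G,p,q}` of a finite graph `G`, an inner set `In ∋ x`, a
block `Blk` and a far vertex `y ∉ In ∪ Blk`, write, for a datum `d = (U, R)`,
`F d = {𝒞 = U, 𝒟 = R, rim wired through U}` (on the configuration restricted to `E(G)`),
`InP d = {x joined inside U to a vertex carrying an open edge to R}` (inside piece) and
`OutP d = {some rim vertex joined to y by an open path avoiding U}` (outside piece). Then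
(`openConn_eq_sum_add_notWired`)

  `P[x ↔ y] = Σ_d P[F d ∩ OutP d] · (P[F d ∩ InP d] / P[F d]) + P[{x ↔ y} ∩ {rim not wired}]`:

partition `{x ↔ y}` according to the actual datum `(𝒞, 𝒟)` (the events `F d` are pairwise
disjoint and, together with `{rim not wired}`, exhaust everything); on `F d` the connection splits
as `InP d ∩ OutP d` (first exit from / last visit to `U`, glued back through the linked rim:
`openConn_iff_of_mem_explEvent`), `InP d` is determined by the edges touching `U` and `OutP d` by
the other edges, so the rim-wiring Markov property factorises
`P[F d ∩ InP d ∩ OutP d] · P[F d] = P[F d ∩ InP d] · P[F d ∩ OutP d]`. This is Kesten's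
"`P[x ↔ y] = Σ t(d) u_x(d) + junk`" (H. Kesten, PTRF 73 (1986), proof of Thm. 3, eqs. (15)–(17))
in the planarity-free form of Basu–Sapozhnikov (§2, eq. (2.4)): the weights
`t(d) = P[F d ∩ OutP d]` depend on the graph away from the block, the conditional inside
probabilities `u_x(d) = P[F d ∩ InP d] / P[F d]` do not.

Everything is proved; no definitions, no named facts.

## References
* [BasuSapozhnikov2017ECP] D. Basu, A. Sapozhnikov, *Kesten's incipient infinite cluster and
  quasi-multiplicativity of crossing probabilities*, Electron. Commun. Probab. 22 (2017) no. 26,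
  §2, eq. (2.4).
* [Kesten1986] H. Kesten, The incipient infinite cluster in two-dimensional percolation,
  *Probab. Theory Related Fields* 73 (1986) 369–394, proof of Thm. 3, eqs. (15)–(17).
* G. Grimmett, *The Random-Cluster Model*, Springer (2006), §4.2, Lemma (4.13).
-/

open MeasureTheory Finset SimpleGraph
open Literature.Probability.Percolation (BondConfig openConn openConnIn explSet explRim explEvent explRimWired)

namespace Literature.Probability.LatticeModels

/-! ### Event algebra -/

/-- Membership in the saturated wired datum event, read on the exploration data: the restricted
configuration has explored set `U`, rim `R`, and its rim is wired from inside.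
[cite: BasuSapozhnikov2017ECP, §2 eq. (2.4)] -/
private theorem top_mem_wiredEvent_iff {V : Type*} {E : Set (Sym2 V)} {In Blk U R : Set V}
    {ω : BondConfig V} :
    ω ∈ {ω : BondConfig V | ω ∩ E ∈ explEvent In Blk U R ∩
        {ω | ∀ r ∈ R, ∀ r₂ ∈ R, ∃ v ∈ U, ∃ v' ∈ U,
          s(v, r) ∈ ω ∧ s(v', r₂) ∈ ω ∧ ω ∈ openConnIn U v v'}} ↔
      explSet In Blk (ω ∩ E) = U ∧ explRim In Blk (ω ∩ E) = R ∧ explRimWired In Blk (ω ∩ E) := by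
  constructor
  · rintro ⟨⟨hU, hR⟩, hw⟩
    subst hU hR
    exact ⟨rfl, rfl, hw⟩
  · rintro ⟨rfl, rfl, hw⟩
    exact ⟨⟨rfl, rfl⟩, hw⟩

/-- The inside piece `{∃ w ∈ R, ∃ v ∈ U, x ↔ v inside U, vw open}` (on the configuration restricted
to `E`) passes between configurations agreeing on a set of pairs `T` containing every pair of `E`
issuing from `U`. [cite: Kesten1986, proof of Thm. 3, eqs. (15)–(17)] -/
private theorem top_inP_of_agree {V : Type*} {E T : Set (Sym2 V)} {U R : Set V} {x : V}
    (hT : ∀ a ∈ U, ∀ b : V, s(a, b) ∈ E → s(a, b) ∈ T) {ω₁ ω₂ : BondConfig V}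
    (h : ω₁ ∩ T = ω₂ ∩ T)
    (h₁ : ∃ w ∈ R, ∃ v ∈ U, ω₁ ∩ E ∈ openConnIn U x v ∧ s(v, w) ∈ ω₁ ∩ E) :
    ∃ w ∈ R, ∃ v ∈ U, ω₂ ∩ E ∈ openConnIn U x v ∧ s(v, w) ∈ ω₂ ∩ E := by
  have key : ∀ a ∈ U, ∀ b : V, s(a, b) ∈ ω₁ ∩ E → s(a, b) ∈ ω₂ ∩ E := by
    intro a ha b hab
    have h' : s(a, b) ∈ ω₁ ∩ T := ⟨hab.1, hT a ha b hab.2⟩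
    rw [h] at h'
    exact ⟨h'.1, hab.2⟩
  obtain ⟨w, hw, v, hv, hxv, hvw⟩ := h₁
  exact ⟨w, hw, v, hv, Percolation.BlockExploration.openConnIn_of_agree hxv
    fun a ha b _ hab => key a ha b hab, key v hv w hvw⟩

/-- The outside piece `{∃ w ∈ R, w ↔ y avoiding U}` (on the configuration restricted to `E`)
passes between configurations agreeing on a set of pairs `D` containing every pair of `E` with
both endpoints off `U`. [cite: Kesten1986, proof of Thm. 3, eqs. (15)–(17)] -/
private theorem top_outP_of_agree {V : Type*} {E D : Set (Sym2 V)} {U R : Set V} {y : V}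
    (hD : ∀ a, a ∉ U → ∀ b, b ∉ U → s(a, b) ∈ E → s(a, b) ∈ D) {ω₁ ω₂ : BondConfig V}
    (h : ω₁ ∩ D = ω₂ ∩ D) (h₁ : ∃ w ∈ R, ω₁ ∩ E ∈ openConnIn Uᶜ w y) :
    ∃ w ∈ R, ω₂ ∩ E ∈ openConnIn Uᶜ w y := by
  obtain ⟨w, hw, hwy⟩ := h₁
  refine ⟨w, hw, Percolation.BlockExploration.openConnIn_of_agree hwy fun a ha b hb hab => ?_⟩
  have h' : s(a, b) ∈ ω₁ ∩ D := ⟨hab.1, hD a ha b hb hab.2⟩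
  rw [h] at h'
  exact ⟨h'.1, hab.2⟩

/-! ### Arithmetic of the conditional factorisation -/

/-- If `D = A ∩ C` on `F`, `F` is not null and `μ(F ∩ A ∩ C) μ(F) = μ(F ∩ A) μ(F ∩ C)`, then
`μ(F ∩ D) = μ(F ∩ C) · (μ(F ∩ A) / μ(F))`. [folklore] -/
private theorem top_cond_arith {α : Type*} [MeasurableSpace α] {μ : Measure α} {F A C D : Set α}
    (h0 : μ.real F ≠ 0) (hD : ∀ ω ∈ F, ω ∈ D ↔ ω ∈ A ∧ ω ∈ C)
    (hM : μ.real (F ∩ A ∩ C) * μ.real F = μ.real (F ∩ A) * μ.real (F ∩ C)) :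
    μ.real (F ∩ C) * (μ.real (F ∩ A) / μ.real F) = μ.real (F ∩ D) := by
  have hset : F ∩ D = F ∩ A ∩ C := by
    ext ω
    simp only [Set.mem_inter_iff]
    constructor
    · rintro ⟨hF, hωD⟩
      exact ⟨⟨hF, ((hD ω hF).1 hωD).1⟩, ((hD ω hF).1 hωD).2⟩
    · rintro ⟨⟨hF, hA⟩, hC⟩
      exact ⟨hF, (hD ω hF).2 ⟨hA, hC⟩⟩
  rw [hset, ← mul_div_assoc, div_eq_iff h0, hM, mul_comm]

/-! ### The summand: factorisation on one datum event -/

/-- **On one wired datum event the connection factorises.** For `x ∈ In`, `y ∉ In ∪ Blk` and the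
saturated wired datum event `F = {𝒞 = U, 𝒟 = R, rim wired through U}` of the free random-cluster
measure `P`: `P[F ∩ OutP] · (P[F ∩ InP] / P[F]) = P[F ∩ {x ↔ y}]`. On `F`, `{x ↔ y} = InP ∩ OutP`
(`openConn_iff_of_mem_explEvent`); `InP` is determined by the edges touching `U`, `OutP` by the
other edges, and the rim-wiring Markov property (`rcMeasure_real_condIndep_of_rim_wired_outside`,
hypotheses from `explEvent_wired_rimHyps`) factorises.
[cite: Kesten1986, proof of Thm. 3, eqs. (15)–(17)] -/
private theorem top_summand_eq {V : Type*} [Fintype V] [DecidableEq V] (G : SimpleGraph V)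
    [DecidableRel G.Adj] {p q : ℝ} (hp : p ∈ Set.Icc (0 : ℝ) 1) (hq : 0 < q) {In Blk : Set V}
    (U R : Set V) {x y : V} (hx : x ∈ In) (hy : y ∉ In ∪ Blk) (F : Set (BondConfig V))
    (hF : F = {ω | ω ∩ (↑G.edgeFinset : Set (Sym2 V)) ∈ explEvent In Blk U R ∩
      {ω | ∀ r ∈ R, ∀ r₂ ∈ R, ∃ v ∈ U, ∃ v' ∈ U,
        s(v, r) ∈ ω ∧ s(v', r₂) ∈ ω ∧ ω ∈ openConnIn U v v'}}) :
    (rcMeasure G p q ∅).real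
          (F ∩ {ω | ∃ w ∈ R, ω ∩ (↑G.edgeFinset : Set (Sym2 V)) ∈ openConnIn Uᶜ w y}) *
        ((rcMeasure G p q ∅).real (F ∩ {ω | ∃ w ∈ R, ∃ v ∈ U,
            ω ∩ (↑G.edgeFinset : Set (Sym2 V)) ∈ openConnIn U x v ∧
              s(v, w) ∈ ω ∩ (↑G.edgeFinset : Set (Sym2 V))}) /
          (rcMeasure G p q ∅).real F) =
      (rcMeasure G p q ∅).real
        (F ∩ {ω | ω ∩ (↑G.edgeFinset : Set (Sym2 V)) ∈ openConn x y}) := by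
  classical
  haveI := isProbabilityMeasure_rcMeasure G hp hq ∅
  by_cases hF0 : (rcMeasure G p q ∅).real F = 0
  · -- a null datum event contributes nothing
    rw [hF0, div_zero, mul_zero]
    exact (measureReal_mono_null Set.inter_subset_left hF0).symm
  -- `F` is nonempty: read off `x ∈ U`, `y ∉ U` and `R ∩ U = ∅` from one of its configurations
  obtain ⟨ω₀, hω₀⟩ : F.Nonempty :=
    Set.nonempty_iff_ne_empty.2 fun h => hF0 (by rw [h, measureReal_empty])
  subst hF
  obtain ⟨hU₀, hR₀, -⟩ := top_mem_wiredEvent_iff.1 hω₀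
  have hxU : x ∈ U := by
    rw [← hU₀]
    exact Percolation.subset_explSet In Blk _ hx
  have hyU : y ∉ U := by
    rw [← hU₀]
    exact fun h => hy (Percolation.explSet_subset In Blk _ h)
  have hRU : ∀ r ∈ R, r ∉ U := by
    rw [← hU₀, ← hR₀]
    exact fun r hr hrU => (Percolation.mem_explRim_iff.1 hr).1 hrU
  -- the `G`-edges touching `U`, and the three hypotheses of the Markov property
  obtain ⟨T, hT⟩ : ∃ T : Finset (Sym2 V), ∀ e, e ∈ T ↔ e ∈ G.edgeFinset ∧ ∃ v ∈ U, v ∈ e :=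
    ⟨G.edgeFinset.filter (fun e => ∃ v ∈ U, v ∈ e), fun e => Finset.mem_filter⟩
  obtain ⟨hFdet, hFrim, hFwire⟩ := explEvent_wired_rimHyps G In Blk U R T hT
  have hTU : ∀ a ∈ U, ∀ b : V, s(a, b) ∈ (↑G.edgeFinset : Set (Sym2 V)) →
      s(a, b) ∈ (↑T : Set (Sym2 V)) := fun a ha b hab =>
    Finset.mem_coe.2 ((hT _).2 ⟨Finset.mem_coe.1 hab, a, ha, Sym2.mem_mk_left a b⟩)
  have hDU : ∀ a, a ∉ U → ∀ b, b ∉ U → s(a, b) ∈ (↑G.edgeFinset : Set (Sym2 V)) →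
      s(a, b) ∈ (↑(G.edgeFinset \ T) : Set (Sym2 V)) := by
    intro a ha b hb hab
    refine Finset.mem_coe.2 (Finset.mem_sdiff.2 ⟨Finset.mem_coe.1 hab, fun hT' => ?_⟩)
    obtain ⟨-, v, hv, hve⟩ := (hT _).1 hT'
    rcases Sym2.mem_iff.1 hve with rfl | rfl
    exacts [ha hv, hb hv]
  -- the Markov property for the inside piece `A` and the outside piece `C`, and (E7) on `F`
  refine top_cond_arith hF0 (fun ω hω => ?_)
    (rcMeasure_real_condIndep_of_rim_wired_outside G hp hq ∅ U R T hT hRU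
      (fun b hb => (Set.notMem_empty b hb).elim) _ hFdet hFrim hFwire _ _
      (fun ω₁ ω₂ h => ⟨top_inP_of_agree hTU h, top_inP_of_agree hTU h.symm⟩)
      (fun ω₁ ω₂ h => ⟨top_outP_of_agree hDU h, top_outP_of_agree hDU h.symm⟩))
  obtain ⟨hU, hR, hW⟩ := top_mem_wiredEvent_iff.1 hω
  exact Percolation.openConn_iff_of_mem_explEvent ⟨hU, hR⟩
    (Percolation.explRimLinked_of_explRimWired hW) hxU hyU

/-! ### The partition by the exploration data -/

/-- Splitting of indicator masses: if `PS ↔ PW` then `[PA] = [PS ∧ PA] + [PA ∧ ¬ PW]`.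
[folklore] -/
private theorem top_ite_split {c : ℝ} {PA PS PW : Prop} {_ : Decidable PA}
    {_ : Decidable (PS ∧ PA)} {_ : Decidable (PA ∧ ¬ PW)} (h : PS ↔ PW) :
    (if PA then c else 0) = (if PS ∧ PA then c else 0) + (if PA ∧ ¬ PW then c else 0) := by
  by_cases hA : PA <;> by_cases hW : PW <;> simp [hA, hW, h]

/-- **Partition by the exploration data.** For every event `A` of the free random-cluster
measure `P` of `G`: `P[A] = Σ_{d = (U, R)} P[F d ∩ A] + P[A ∩ {rim not wired}]`, where `F d` is the
saturated wired datum event — every configuration lies in the datum event of its own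
`(𝒞, 𝒟)` and in no other, and lies in the wired one iff its rim is wired from inside; the measure
is a finite sum of point masses, so the identity is checked configuration by configuration.
[cite: BasuSapozhnikov2017ECP, §2 eq. (2.4)] -/
private theorem top_real_eq_sum_add {V : Type*} [Fintype V] [DecidableEq V] (G : SimpleGraph V)
    [DecidableRel G.Adj] {p q : ℝ} (hp : p ∈ Set.Icc (0 : ℝ) 1) (hq : 0 < q) (In Blk : Set V)
    (A : Set (BondConfig V)) :
    (rcMeasure G p q ∅).real A =
      (∑ d ∈ (Finset.univ : Finset (Finset V × Finset V)),
        (rcMeasure G p q ∅).real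
          ({ω | ω ∩ (↑G.edgeFinset : Set (Sym2 V)) ∈
              explEvent In Blk (↑d.1 : Set V) (↑d.2 : Set V) ∩
            {ω | ∀ r ∈ (↑d.2 : Set V), ∀ r₂ ∈ (↑d.2 : Set V), ∃ v ∈ (↑d.1 : Set V),
              ∃ v' ∈ (↑d.1 : Set V), s(v, r) ∈ ω ∧ s(v', r₂) ∈ ω ∧ ω ∈ openConnIn ↑d.1 v v'}} ∩
            A)) +
        (rcMeasure G p q ∅).real
          (A ∩ {ω | ¬ explRimWired In Blk (ω ∩ (↑G.edgeFinset : Set (Sym2 V)))}) := by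
  classical
  simp only [rcMeasure_real_apply G hp hq ∅]
  rw [Finset.sum_comm, ← Finset.sum_add_distrib]
  refine Finset.sum_congr rfl fun η _ => ?_
  -- the datum of the configuration `↑η`
  obtain ⟨d₀, hd₁, hd₂⟩ : ∃ d₀ : Finset V × Finset V,
      (↑d₀.1 : Set V) = explSet In Blk ((↑η : BondConfig V) ∩ ↑G.edgeFinset) ∧
        (↑d₀.2 : Set V) = explRim In Blk ((↑η : BondConfig V) ∩ ↑G.edgeFinset) :=
    ⟨((Set.toFinite _).toFinset, (Set.toFinite _).toFinset), Set.Finite.coe_toFinset _,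
      Set.Finite.coe_toFinset _⟩
  rw [Finset.sum_eq_single d₀]
  · exact top_ite_split
      (top_mem_wiredEvent_iff.trans ⟨fun h => h.2.2, fun hW => ⟨hd₁.symm, hd₂.symm, hW⟩⟩)
  · intro d _ hne
    refine if_neg fun hd => hne ?_
    obtain ⟨h1, h2, -⟩ := top_mem_wiredEvent_iff.1 hd.1
    exact Prod.ext (Finset.coe_inj.1 (h1.symm.trans hd₁.symm))
      (Finset.coe_inj.1 (h2.symm.trans hd₂.symm))
  · exact fun h => absurd (Finset.mem_univ _) h

/-! ### The top-level identity -/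

/-- **The top-level identity of Kesten's ratio-limit scheme** (Kesten 1986, proof of Thm. 3,
eqs. (15)–(17); Basu–Sapozhnikov 2017, §2, eq. (2.4), planarity-free). For the free random-cluster
measure `P` of a finite graph `G` (`0 ≤ p ≤ 1`, `q > 0`), an inner set `In ∋ x`, a block `Blk` and
a far vertex `y ∉ In ∪ Blk`: with `F d` the saturated wired datum event of `d = (U, R)`, `InP d`
the inside piece (`x` joined inside `U` to a vertex carrying an open edge to `R`) and `OutP d` the
outside piece (a rim vertex joined to `y` avoiding `U`),
`P[x ↔ y] = Σ_d P[F d ∩ OutP d] · (P[F d ∩ InP d] / P[F d]) + P[{x ↔ y} ∩ {rim not wired}]` —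
the connection probability is a `t`-weighted sum of the CONDITIONAL inside probabilities
`u_x(d) = P[F d ∩ InP d] / P[F d]` (graph-independent by the Markov property), up to the mass of
the configurations whose rim is not wired from inside (Kesten 1986, proof of Thm. 3,
eqs. (15)–(17)). [cite: BasuSapozhnikov2017ECP, §2 eq. (2.4)] -/
theorem openConn_eq_sum_add_notWired :
    ∀ {V : Type*} [Fintype V] [DecidableEq V] (G : SimpleGraph V) [DecidableRel G.Adj] {p q : ℝ}, p ∈ Set.Icc (0 : ℝ) 1 → 0 < q → ∀ (In Blk : Set V) (x y : V), x ∈ In → y ∉ In → y ∉ Blk → (∀ v ∈ In ∪ Blk, ¬ G.Adj v y) → (∀ v ∈ In, ∀ w : V, G.Adj v w → w ∈ In ∪ Blk) → let Eg : Set (Sym2 V) := ↑G.edgeFinset; let P := Literature.Probability.LatticeModels.rcMeasure G p q ∅; let F : Set V → Set V → Set (Literature.Probability.Percolation.BondConfig V) := fun U R => {ω | ω ∩ Eg ∈ Literature.Probability.Percolation.explEvent In Blk U R ∩ {ω | ∀ r ∈ R, ∀ r₂ ∈ R, ∃ v ∈ U, ∃ v' ∈ U, s(v, r) ∈ ω ∧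 s(v', r₂) ∈ ω ∧ ω ∈ Literature.Probability.Percolation.openConnIn U v v'}}; let InP : Set V → Set V → Set (Literature.Probability.Percolation.BondConfig V) := fun U R => {ω | ∃ w ∈ R, ∃ v ∈ U, ω ∩ Eg ∈ Literature.Probability.Percolation.openConnIn U x v ∧ s(v, w) ∈ ω ∩ Eg}; let OutP : Set V → Set V → Set (Literature.Probability.Percolation.BondConfig V) := fun U R => {ω | ∃ w ∈ R, ω ∩ Eg ∈ Literature.Probability.Percolation.openConnIn Uᶜ w y}; let NW : Set (Literature.Probability.Percolation.BondConfig V) := {ω | ¬ Literature.Probability.Percolation.explRimWired In Blk (ω ∩ Eg)}; P.real {ω | ω ∩ Eg ∈ Literature.Probability.Percolation.openConn x y} = (∑ d ∈ (Finset.univ : Finset (Finset V × Finset V)), P.real (F ↑d.1 ↑d.2 ∩ OutP ↑d.1 ↑d.2) * (P.real (F ↑d.1 ↑d.2 ∩ InP ↑d.1 ↑d.2) / P.real (F ↑d.1 ↑d.2))) + P.real ({ω | ω ∩ Eg ∈ Literature.Probability.Percolation.openConn x y} ∩ NW) := by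
  intro V _ _ G _ p q hp hq In Blk x y hx hyIn hyBlk _ _
  have hy : y ∉ In ∪ Blk := fun h => h.elim hyIn hyBlk
  refine (top_real_eq_sum_add G hp hq In Blk _).trans ?_
  congr 1
  exact Finset.sum_congr rfl fun d _ => (top_summand_eq G hp hq _ _ hx hy _ rfl).symm

end Literature.Probability.LatticeModels
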